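import Mathlib
import HarnessLib
import Summits.CriticalPhenomena.PercolationContinuityZ3.Theorems.PercLowPointHalfSpaceBoundaryTwoArmDecayStubCensusDefs

/-!
# Crux `PercLowPointHalfSpace.BoundaryTwoArmDecay` (stmt-CriticalPhenomena-0911), line
# `staircase-bootstrap-floor-decoupling` — stub `stub_census`, part I: covariance, finiteness, the floor root

Helper file for the registered stub `stub_census` (TRUNCATED LEVEL CENSUS `P(A_n ∧ K_n ≤ k) ≤ C·k·e_n`) of the
skeleton `Cruxes/BoundaryTwoArmDecay/Lines/staircase_bootstrap_floor_decoupling.lean`; lands with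
`--supports stmt-CriticalPhenomena-0911` (registered sub-goal `stub_census_floorRoot`). Definition-free; the
objects (`cl`, `fl`, `tall`, `Hm = ℍ₋₁`, `e₀`, `PK`, `J`, `staple`, `EH`) are those of
`PercLowPointHalfSpaceBoundaryTwoArmDecayStubCensusDefs.lean`.

* covariance of `cl`, `fl`, `tall`, `PK`, `J` under the HORIZONTAL shifts `ω ↦ ω + v` (`v₀ = 0`) of `ℤ³`
  (`shift_mem_openConnIn_iff` of `HalfSpacePinnedPairs.lean`);
* the staple under a floor lattice edge consists of at most three lattice edges, none a pair of vertices of `ℍ`;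
* on the full-measure event of Barsky–Grimmett–Newman at `p_c(ℤ³)` (`ae_good`: `ω ⊆ E(ℤ³)` and every shifted
  half-space cluster finite, `LowPoint.ae_forall_finite_halfSpaceCluster_shift`) the clusters `C_ℍ(a)` (`a ∈ ∂ℍ`)
  and `C_{ℍ₋₁}(a)` (`a ∈ ∂ℍ₋₁`) are finite;
* `stub_census_floorRoot` — every vertex of level `≥ 0` of the `ℍ₋₁`-cluster of `-e₀` is joined INSIDE `ℍ` to a
  floor point of that cluster (`LowPoint.exists_bushRoot` one level down, by the vertical shift).

Sources: G. Grimmett, *Percolation* (1999), §7.2 (paths "in `A`"), Thm. (7.35) (BGN); the objects extend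
`Literature/Probability/Percolation/HalfSpacePinnedPairs.lean`.
-/

noncomputable section

namespace Summit.CriticalPhenomena.PercolationContinuityZ3.Theorems.BoundaryTwoArmDecay

open MeasureTheory Filter Topology
open Literature.Probability.Percolation Literature.Probability.LatticeModels
open scoped ENNReal

namespace StubCensus

open LowPoint (conn_symm conn_trans conn_refl conn_mono conn_iff_mem_cluster lintegral_shift)
open Negative (μ)

/-! ### Horizontal shifts -/

/-- Level sets and level half-spaces are invariant under horizontal shifts. -/
theorem add_mem_level_iff {v : Site 3} (hv : v 0 = 0) (l : ℤ) (u : Site 3) :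
    u + v ∈ {x : Site 3 | l ≤ x 0} ↔ u ∈ {x : Site 3 | l ≤ x 0} := by
  simp only [Set.mem_setOf_eq, Pi.add_apply, hv, add_zero]

/-- `ℍ + v = ℍ` for horizontal `v`. -/
theorem add_mem_halfSpace_iff {v : Site 3} (hv : v 0 = 0) (u : Site 3) :
    u + v ∈ halfSpace 3 ↔ u ∈ halfSpace 3 :=
  add_mem_level_iff hv 0 u

/-- `ℍ₋₁ + v = ℍ₋₁` for horizontal `v`. -/
theorem add_mem_Hm_iff {v : Site 3} (hv : v 0 = 0) (u : Site 3) : u + v ∈ Hm ↔ u ∈ Hm :=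
  add_mem_level_iff hv (-1) u

/-- Covariance of `cl` under horizontal shifts (membership form), for a horizontally invariant region. -/
theorem mem_cl_shift_iff {R : Set (Site 3)} {v : Site 3} (hR : ∀ u, u + v ∈ R ↔ u ∈ R) (a u : Site 3)
    (ω : BondConfig (Site 3)) : u + v ∈ cl R (a + v) (BondConfig.relabel (sym2Equiv (Site.shift (v))) ω) ↔ u ∈ cl R a ω :=
  shift_mem_openConnIn_iff v hR ω a u

/-- Covariance of `cl` under horizontal shifts (image form). -/
theorem cl_shift {R : Set (Site 3)} {v : Site 3} (hR : ∀ u, u + v ∈ R ↔ u ∈ R) (a : Site 3)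
    (ω : BondConfig (Site 3)) : cl R (a + v) (BondConfig.relabel (sym2Equiv (Site.shift (v))) ω) = (· + v) '' cl R a ω := by
  ext u
  constructor
  · intro hu
    refine ⟨u - v, (mem_cl_shift_iff hR a (u - v) ω).1 ?_, sub_add_cancel u v⟩
    rwa [sub_add_cancel]
  · rintro ⟨w, hw, rfl⟩
    exact (mem_cl_shift_iff hR a w ω).2 hw

/-- Covariance of the slice sizes under horizontal shifts. -/
theorem fl_shift {R : Set (Site 3)} {v : Site 3} (hv : v 0 = 0) (hR : ∀ u, u + v ∈ R ↔ u ∈ R) (l : ℤ)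
    (a : Site 3) (ω : BondConfig (Site 3)) : fl R l (a + v) (BondConfig.relabel (sym2Equiv (Site.shift (v))) ω) = fl R l a ω := by
  rw [fl, fl, cl_shift hR]
  have hset : (· + v) '' cl R a ω ∩ {u : Site 3 | u 0 = l} = (· + v) '' (cl R a ω ∩ {u | u 0 = l}) := by
    ext u
    simp only [Set.mem_inter_iff, Set.mem_image, Set.mem_setOf_eq]
    constructor
    · rintro ⟨⟨w, hw, rfl⟩, hl⟩
      refine ⟨w, ⟨hw, ?_⟩, rfl⟩
      simpa [Pi.add_apply, hv] using hl
    · rintro ⟨w, ⟨hw, hl⟩, rfl⟩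
      exact ⟨⟨w, hw, rfl⟩, by simpa [Pi.add_apply, hv] using hl⟩
  rw [hset, (add_left_injective v).injOn.encard_image]

/-- Covariance of tallness under horizontal shifts. -/
theorem tall_shift_iff {R : Set (Site 3)} {v : Site 3} (hv : v 0 = 0) (hR : ∀ u, u + v ∈ R ↔ u ∈ R)
    (n : ℕ) (a : Site 3) (ω : BondConfig (Site 3)) : BondConfig.relabel (sym2Equiv (Site.shift (v))) ω ∈ tall R n (a + v) ↔ ω ∈ tall R n a := by
  constructor
  · rintro ⟨y, hy, h⟩
    refine ⟨y - v, ?_, (shift_mem_openConnIn_iff v hR ω a (y - v)).1 (by rwa [sub_add_cancel])⟩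
    simpa [Pi.sub_apply, hv] using hy
  · rintro ⟨y, hy, h⟩
    refine ⟨y + v, ?_, (shift_mem_openConnIn_iff v hR ω a y).2 h⟩
    simpa [Pi.add_apply, hv] using hy

/-- Covariance of the partner-kiss edges under horizontal shifts (membership form). -/
theorem mem_PK_shift_iff {v : Site 3} (hv : v 0 = 0) (n : ℕ) (a : Site 3) (ω : BondConfig (Site 3))
    (q : Site 3 × Site 3) : (q.1 + v, q.2 + v) ∈ PK n (a + v) (BondConfig.relabel (sym2Equiv (Site.shift (v))) ω) ↔ q ∈ PK n a ω := by
  have hR := add_mem_halfSpace_iff (v := v) hv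
  simp only [PK, Set.mem_setOf_eq, Pi.add_apply, hv, add_zero, shift_mem_openConnIn_iff v hR,
    tall_shift_iff hv hR]
  have hadj : (zdGraph 3).Adj (q.1 + v) (q.2 + v) ↔ (zdGraph 3).Adj q.1 q.2 :=
    zdGraph_adj_shift_iff v q.1 q.2
  rw [hadj]

/-- Covariance of the partner-kiss edges under horizontal shifts (image form). -/
theorem PK_shift {v : Site 3} (hv : v 0 = 0) (n : ℕ) (a : Site 3) (ω : BondConfig (Site 3)) :
    PK n (a + v) (BondConfig.relabel (sym2Equiv (Site.shift (v))) ω) = (fun q : Site 3 × Site 3 => (q.1 + v, q.2 + v)) '' PK n a ω := by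
  ext q
  constructor
  · intro hq
    refine ⟨(q.1 - v, q.2 - v), (mem_PK_shift_iff hv n a ω (q.1 - v, q.2 - v)).1 ?_, ?_⟩
    · simpa only [sub_add_cancel] using hq
    · simp only [sub_add_cancel]
  · rintro ⟨q', hq', rfl⟩
    exact (mem_PK_shift_iff hv n a ω q').2 hq'

/-- The pair shift is injective. -/
theorem pairShift_injective (v : Site 3) :
    Function.Injective fun q : Site 3 × Site 3 => (q.1 + v, q.2 + v) := by
  intro q q' h
  simp only [Prod.mk.injEq, add_left_inj] at h
  exact Prod.ext h.1 h.2

/-- Covariance of `J` under horizontal shifts. -/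
theorem J_shift {v : Site 3} (hv : v 0 = 0) (n : ℕ) (a : Site 3) (ω : BondConfig (Site 3)) :
    J n (a + v) (BondConfig.relabel (sym2Equiv (Site.shift (v))) ω) = J n a ω := by
  rw [J, J]
  rw [← (Equiv.addRight v).tsum_eq (fun γ => {γ : Site 3 | γ 0 = 0 ∧ γ ∈ cl Hm (a + v) (BondConfig.relabel (sym2Equiv (Site.shift (v))) ω) ∧
      BondConfig.relabel (sym2Equiv (Site.shift (v))) ω ∈ tall (halfSpace 3) n γ}.indicator
    (fun γ => (((fl (halfSpace 3) 0 γ (BondConfig.relabel (sym2Equiv (Site.shift (v))) ω) : ℕ∞) : ℝ≥0∞))⁻¹) γ)]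
  refine tsum_congr fun γ => ?_
  simp only [Equiv.coe_addRight]
  have hmem : γ + v ∈ {γ : Site 3 | γ 0 = 0 ∧ γ ∈ cl Hm (a + v) (BondConfig.relabel (sym2Equiv (Site.shift (v))) ω) ∧
      BondConfig.relabel (sym2Equiv (Site.shift (v))) ω ∈ tall (halfSpace 3) n γ} ↔
      γ ∈ {γ : Site 3 | γ 0 = 0 ∧ γ ∈ cl Hm a ω ∧ ω ∈ tall (halfSpace 3) n γ} := by
    simp only [Set.mem_setOf_eq, Pi.add_apply, hv, add_zero, mem_cl_shift_iff (add_mem_Hm_iff hv),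
      tall_shift_iff hv (add_mem_halfSpace_iff hv)]
  by_cases h : γ ∈ {γ : Site 3 | γ 0 = 0 ∧ γ ∈ cl Hm a ω ∧ ω ∈ tall (halfSpace 3) n γ}
  · rw [Set.indicator_of_mem (hmem.2 h), Set.indicator_of_mem h,
      fl_shift hv (add_mem_halfSpace_iff hv)]
  · rw [Set.indicator_of_notMem (fun h' => h (hmem.1 h')), Set.indicator_of_notMem h]

/-! ### The staple -/

/-- The staple edges are lattice edges when `g` is a floor lattice edge. -/
theorem staple_subset_edgeSet {g : Site 3 × Site 3} (hadj : (zdGraph 3).Adj g.1 g.2) :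
    (↑(staple g) : Set (Sym2 (Site 3))) ⊆ (zdGraph 3).edgeSet := by
  have hdown : ∀ q : Site 3, (zdGraph 3).Adj q (q - e₀) := fun q =>
    (zdGraph_adj_iff q (q - e₀)).2 ⟨0, Or.inr (by rw [e₀, sub_add_cancel])⟩
  intro z hz
  simp only [staple, Finset.coe_insert, Finset.coe_singleton, Set.mem_insert_iff,
    Set.mem_singleton_iff] at hz
  rcases hz with rfl | rfl | rfl
  · exact hdown g.1
  · rw [SimpleGraph.mem_edgeSet]
    have := (zdGraph_adj_shift_iff (-e₀) g.1 g.2).2 hadj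
    simpa only [Site.shift_apply, ← sub_eq_add_neg] using this
  · rw [SimpleGraph.mem_edgeSet]
    exact (hdown g.2).symm

/-- The staple has at most three edges. -/
theorem card_staple_le (g : Site 3 × Site 3) : (staple g).card ≤ 3 := by
  rw [staple]
  exact Finset.card_le_three

/-- The staple edges are not pairs of vertices of `ℍ` (each has an endpoint at level `-1`). -/
theorem disjoint_staple_EH {g : Site 3 × Site 3} (h1 : g.1 0 = 0) (h2 : g.2 0 = 0) :
    Disjoint (↑(staple g) : Set (Sym2 (Site 3))) EH := by
  rw [Set.disjoint_left]
  intro z hz hzE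
  simp only [staple, Finset.coe_insert, Finset.coe_singleton, Set.mem_insert_iff,
    Set.mem_singleton_iff] at hz
  have hl1 : g.1 - e₀ ∉ halfSpace 3 := by
    simp [halfSpace_eq, Pi.sub_apply, h1, e₀]
  have hl2 : g.2 - e₀ ∉ halfSpace 3 := by
    simp [halfSpace_eq, Pi.sub_apply, h2, e₀]
  rcases hz with rfl | rfl | rfl
  · exact hl1 (mem_edgeSet_withinGraph.1 hzE).2.2
  · exact hl1 (mem_edgeSet_withinGraph.1 hzE).2.1
  · exact hl2 (mem_edgeSet_withinGraph.1 hzE).2.1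

/-! ### Almost sure finiteness of the clusters (Barsky–Grimmett–Newman) -/

/-- If every shifted half-space cluster of `ω` is finite, the cluster of `a` in the half-space at its own
level is finite. -/
theorem finite_cl_level {ω : BondConfig (Site 3)}
    (hfin : ∀ v : Site 3, (halfSpaceCluster (BondConfig.relabel (sym2Equiv (Site.shift v)) ω)).Finite)
    (a : Site 3) : (cl {x : Site 3 | a 0 ≤ x 0} a ω).Finite := by
  have hpre : cl {x : Site 3 | a 0 ≤ x 0} a ω ⊆
      (fun u : Site 3 => u - a) ⁻¹' halfSpaceCluster (BondConfig.relabel (sym2Equiv (Site.shift (-a))) ω) := by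
    intro u hu
    rw [Set.mem_preimage, LowPoint.mem_halfSpaceCluster_shift_iff]
    simpa only [mem_cl, neg_neg, Pi.neg_apply, sub_neg_eq_add, sub_add_cancel] using hu
  exact ((hfin (-a)).preimage sub_left_injective.injOn).subset hpre

/-- In particular `C_ℍ(a)` is finite for a floor point `a`. -/
theorem finite_cl_halfSpace {ω : BondConfig (Site 3)}
    (hfin : ∀ v : Site 3, (halfSpaceCluster (BondConfig.relabel (sym2Equiv (Site.shift v)) ω)).Finite)
    {a : Site 3} (ha : a 0 = 0) : (cl (halfSpace 3) a ω).Finite := by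
  have h := finite_cl_level hfin a
  rw [ha] at h
  exact h

/-- And `C_{ℍ₋₁}(a)` is finite for a point `a` of level `-1`. -/
theorem finite_cl_Hm {ω : BondConfig (Site 3)}
    (hfin : ∀ v : Site 3, (halfSpaceCluster (BondConfig.relabel (sym2Equiv (Site.shift v)) ω)).Finite)
    {a : Site 3} (ha : a 0 = -1) : (cl Hm a ω).Finite := by
  have h := finite_cl_level hfin a
  rw [ha] at h
  exact h

/-- The full-measure event on which the census is computed: `ω` opens only lattice edges and every shifted
half-space cluster is finite (BGN at `p_c(ℤ³)`, `LowPoint.ae_forall_finite_halfSpaceCluster_shift`). -/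
theorem ae_good : ∀ᵐ ω ∂μ, ω ⊆ (zdGraph 3).edgeSet ∧
    ∀ v : Site 3, (halfSpaceCluster (BondConfig.relabel (sym2Equiv (Site.shift v)) ω)).Finite := by
  have h1 : ∀ᵐ ω ∂μ, ω ⊆ (zdGraph 3).edgeSet := ProbabilityTheory.setBernoulli_ae_subset
  filter_upwards [h1, LowPoint.ae_forall_finite_halfSpaceCluster_shift (criticalProbI 3) le_rfl] with ω h h'
  exact ⟨h, h'⟩

/-- Shifted configurations of configurations opening only lattice edges open only lattice edges. -/
theorem shift_subset_edgeSet {ω : BondConfig (Site 3)} (hω : ω ⊆ (zdGraph 3).edgeSet) (v : Site 3) :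
    (BondConfig.relabel (sym2Equiv (Site.shift v)) ω : BondConfig (Site 3)) ⊆ (zdGraph 3).edgeSet := by
  intro z
  induction z using Sym2.ind with
  | h a b =>
    intro hz
    rw [BondConfig.mem_relabel_iff, sym2Equiv_symm, sym2Equiv_mk, Site.shift_symm_apply,
      Site.shift_symm_apply] at hz
    have h2 : (zdGraph 3).Adj (a - v) (b - v) := (SimpleGraph.mem_edgeSet _).1 (hω hz)
    have h3 := (zdGraph_adj_shift_iff v (a - v) (b - v)).2 h2
    rw [Site.shift_apply, Site.shift_apply, sub_add_cancel, sub_add_cancel] at h3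
    exact (SimpleGraph.mem_edgeSet _).2 h3

end StubCensus

open LowPoint (conn_symm conn_trans conn_refl conn_mono conn_iff_mem_cluster) in
/-- **A root on the floor** (registered sub-goal `stub_census_floorRoot` of `stub_census`): for a configuration
opening only lattice edges, every vertex `y` of level `≥ 0` of the `ℍ₋₁`-cluster of `-e₀ = (-1,0,0)` is joined
INSIDE `ℍ` to a floor point `c ∈ ∂ℍ` of that cluster (cut an open `ℍ₋₁`-path at its last visit to level
`-1`; here: `LowPoint.exists_bushRoot` read one level down by the vertical shift). -/
theorem stub_census_floorRoot : ∀ (ω : BondConfig (Site 3)) (y : Site 3), ω ⊆ (zdGraph 3).edgeSet → 0 ≤ y 0 →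
    ω ∈ openConnIn {x : Site 3 | -1 ≤ x 0} (-(Pi.single 0 1)) y →
    ∃ c : Site 3, c 0 = 0 ∧ ω ∈ openConnIn {x : Site 3 | -1 ≤ x 0} (-(Pi.single 0 1)) c ∧
      ω ∈ openConnIn (halfSpace 3) c y := by
  intro ω y hω hy0 hy
  have hω' := StubCensus.shift_subset_edgeSet hω StubCensus.e₀
  have hv : y + StubCensus.e₀ ∈ halfSpaceCluster (BondConfig.relabel (sym2Equiv (Site.shift StubCensus.e₀)) ω) := by
    rw [LowPoint.mem_halfSpaceCluster_shift_iff]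
    simpa [StubCensus.e₀] using hy
  have hv1 : 1 ≤ (y + StubCensus.e₀) 0 := by
    simp only [StubCensus.e₀, Pi.add_apply, Pi.single_eq_same]
    omega
  obtain ⟨c, hc, hc0, hce, hcv⟩ := LowPoint.exists_bushRoot hω' hv hv1
  refine ⟨c, hc0, ?_, ?_⟩
  · have h1 : ω ∈ openConnIn {x : Site 3 | -1 ≤ x 0} (-StubCensus.e₀) (c - StubCensus.e₀) := by
      have := (LowPoint.mem_halfSpaceCluster_shift_iff StubCensus.e₀ c ω).1 hc
      simpa [StubCensus.e₀] using this
    have h2 : s(c - StubCensus.e₀, c) ∈ ω := by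
      have key := mk_add_mem_relabel_shift_iff StubCensus.e₀ ω (c - StubCensus.e₀) c
      rw [sub_add_cancel] at key
      exact key.1 hce
    have hne : c - StubCensus.e₀ ≠ c := by
      intro h
      have := congrFun (sub_eq_self.1 h) 0
      simp [StubCensus.e₀] at this
    have hcm : c ∈ {x : Site 3 | -1 ≤ x 0} := by
      show -1 ≤ c 0
      omega
    exact StubCensus.conn_step h1 h2 hne hcm
  · have := (LowPoint.shift_mem_openConnIn_iff_sub StubCensus.e₀ {x : Site 3 | 1 ≤ x 0} ω
      (c + StubCensus.e₀) (y + StubCensus.e₀)).1 hcv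
    rw [LowPoint.preimage_add_level] at this
    simpa [StubCensus.e₀, StubCensus.halfSpace_eq] using this

namespace StubCensus

/-- `stub_census_floorRoot` in the census vocabulary: a vertex of level `≥ 0` of `C_{ℍ₋₁}(-e₀)` is joined
inside `ℍ` to a floor point of `C_{ℍ₋₁}(-e₀)`. -/
theorem exists_floor_root {ω : BondConfig (Site 3)} (hω : ω ⊆ (zdGraph 3).edgeSet) {y : Site 3}
    (hy : y ∈ cl Hm (-e₀) ω) (hy0 : 0 ≤ y 0) :
    ∃ c : Site 3, c 0 = 0 ∧ c ∈ cl Hm (-e₀) ω ∧ ω ∈ openConnIn (halfSpace 3) c y :=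
  stub_census_floorRoot ω y hω hy0 hy

end StubCensus

end Summit.CriticalPhenomena.PercolationContinuityZ3.Theorems.BoundaryTwoArmDecay

end
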